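import Literature.Topology.FourManifolds.RadialExtension
import Mathlib.Analysis.SpecialFunctions.Log.Deriv
import Mathlib.Analysis.Calculus.Deriv.Slope

/-!
# Stub `stub_coneGerm_extendsOverBall` (Z3b) of line `contact-isotopy-gromov-cone` for crux
`SchoenfliesSplit.SchsplitCerf` (stmt-SmoothPoincare4-8758)

A diffeomorphism `Φ` of `ℝ⁴` which, off a compact set `K'`, equals the rescaled cone
`C(y) = ‖y‖ · h(ŷ) · ψ(ŷ)` (`h > 0` smooth on `S³`, `ψ ∈ Diff S³`, `ŷ = y/‖y‖`) yields an
extension of `ψ` over the closed 4-ball (`ExtendsOverBall 3 ψ`), GIVEN the radial-diffeomorphism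
lemma Z3a (`x ↦ g(x) • x` is a diffeomorphism for `g > 0` smooth with `0 ≤ Dg_x(x)`), which is a
hypothesis here (a neighbouring registered stub of the line).

Proof (pure differential topology of `ℝ⁴`):
* normalise `max h ≤ 1` (compose `Φ` with the homothety `1/max h`, rescale `h` and `C`);
* conical rescaling `Φ_λ = λ⁻¹ Φ(λ ·)` with `λ = 4ρ₀`, `K' ⊆ B(0, ρ₀)`: by degree-one homogeneity
  of the cone, `Φ_λ = C` on `{‖x‖ > 1/4}`;
* radial straightening `D(x) = g(x) • x`, `g(x) = exp(radialStep ‖x‖ · (−log h(x̂)))` (`= 1` near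
  `0`, `= 1/h(x̂)` for `‖x‖ ≥ 1/2`, radially non-decreasing because `h ≤ 1`), a diffeomorphism by
  Z3a, with `D(𝔻⁴) = S := {‖x‖ h(x̂) ≤ 1}` and `Φ_λ(S) = 𝔻⁴` (complements: `Φ_λ = C` there and `C`
  has an explicit inverse);
* `G = Φ_λ ∘ D` preserves `𝔻⁴` in both directions and `G z = C(z/h z) = ψ z` on `S³`; restrict with
  `Diffeomorph.closedBallRestrict`.

Source: Geiges, *An Introduction to Contact Topology* (2008), proof of Prop. 4.11.2 (last paragraph).
-/

noncomputable section
-- the prescribed namespace `Summit.<P>.<Sub>.…` duplicates `SmoothPoincare4` (P = Sub)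
set_option linter.dupNamespace false
open scoped Manifold ContDiff Topology
open Set Function Metric Filter
open Literature.Topology.FourManifolds

namespace Summit.SmoothPoincare4.SmoothPoincare4.Theorems.SchsplitCerf.ContactIsotopyGromovCone

/-- The unit 3-sphere `S³ ⊂ ℝ⁴` (notation needed verbatim by the registered stub signature). -/
local notation "𝕊³" => (Metric.sphere (0 : EuclideanSpace ℝ (Fin 4)) 1)
/-- The model `ℝ⁴` (notation needed verbatim by the registered stub signature). -/
local notation "E4" => EuclideanSpace ℝ (Fin 4)

namespace ConeGermExtendsOverBall

variable (ψ : (Metric.sphere (0 : EuclideanSpace ℝ (Fin 4)) 1) ≃ₘ⟮𝓡 3, 𝓡 3⟯ (Metric.sphere (0 :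
    EuclideanSpace ℝ (Fin 4)) 1)) (h : (Metric.sphere (0 : EuclideanSpace ℝ (Fin 4)) 1) → ℝ)

/-! ### The cone given by a pointwise formula -/

/-- The radial projection is invariant under positive rescaling. [folklore] -/
theorem radialProjection_smul_of_pos {c : ℝ} (hc : 0 < c) {x : (EuclideanSpace ℝ (Fin 4))} (hx : x
    ≠ 0) :
    radialProjection (sphereBasePoint 3) (c • x) = radialProjection (sphereBasePoint 3) x := by
  have hcx : c • x ≠ 0 := smul_ne_zero hc.ne' hx
  apply Subtype.ext
  rw [coe_radialProjection_of_ne_zero _ hcx, coe_radialProjection_of_ne_zero _ hx, norm_smul,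
    Real.norm_eq_abs, abs_of_pos hc, mul_inv, smul_smul]
  congr 1
  field_simp

/-- `‖C x‖ = ‖x‖ · h(x̂)` for the cone `C` of `(ψ, h)`, `h > 0`. [folklore] -/
theorem norm_cone_eq {C : (EuclideanSpace ℝ (Fin 4)) → (EuclideanSpace ℝ (Fin 4))}
    (hC : ∀ y : (EuclideanSpace ℝ (Fin 4)), C y = (‖y‖ * h (radialProjection (sphereBasePoint 3)
        y)) •
      ((ψ (radialProjection (sphereBasePoint 3) y) : (Metric.sphere (0 : EuclideanSpace ℝ (Fin 4))
          1)) : (EuclideanSpace ℝ (Fin 4))))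
    (hpos : ∀ z, 0 < h z) (x : (EuclideanSpace ℝ (Fin 4))) :
    ‖C x‖ = ‖x‖ * h (radialProjection (sphereBasePoint 3) x) := by
  rw [hC, norm_smul, norm_eq_of_mem_sphere, mul_one, Real.norm_eq_abs, abs_of_nonneg]
  exact mul_nonneg (norm_nonneg _) (hpos _).le

/-- **Degree-one homogeneity of the cone**: `C(c x) = c C(x)` for `c > 0`. [folklore] -/
theorem cone_smul_eq {C : (EuclideanSpace ℝ (Fin 4)) → (EuclideanSpace ℝ (Fin 4))}
    (hC : ∀ y : (EuclideanSpace ℝ (Fin 4)), C y = (‖y‖ * h (radialProjection (sphereBasePoint 3)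
        y)) •
      ((ψ (radialProjection (sphereBasePoint 3) y) : (Metric.sphere (0 : EuclideanSpace ℝ (Fin 4))
          1)) : (EuclideanSpace ℝ (Fin 4))))
    {c : ℝ} (hc : 0 < c) (x : (EuclideanSpace ℝ (Fin 4))) : C (c • x) = c • C x := by
  by_cases hx : x = 0
  · subst hx
    rw [smul_zero, hC, norm_zero, zero_mul, zero_smul, smul_zero]
  · rw [hC, hC x, radialProjection_smul_of_pos hc hx, norm_smul, Real.norm_eq_abs, abs_of_pos hc,
      smul_smul, mul_assoc]

/-- The cone on a positively rescaled point of the sphere: `C(t z) = (t h z) • ψ z`. [folklore] -/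
theorem cone_smul_coe {C : (EuclideanSpace ℝ (Fin 4)) → (EuclideanSpace ℝ (Fin 4))}
    (hC : ∀ y : (EuclideanSpace ℝ (Fin 4)), C y = (‖y‖ * h (radialProjection (sphereBasePoint 3)
        y)) •
      ((ψ (radialProjection (sphereBasePoint 3) y) : (Metric.sphere (0 : EuclideanSpace ℝ (Fin 4))
          1)) : (EuclideanSpace ℝ (Fin 4))))
    {t : ℝ} (ht : 0 < t) (z : (Metric.sphere (0 : EuclideanSpace ℝ (Fin 4)) 1)) :
    C (t • (z : (EuclideanSpace ℝ (Fin 4)))) = (t * h z) • ((ψ z : (Metric.sphere (0 :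
        EuclideanSpace ℝ (Fin 4)) 1)) : (EuclideanSpace ℝ (Fin 4))) := by
  rw [hC, radialProjection_smul _ ht z, norm_smul, Real.norm_eq_abs, abs_of_pos ht,
    norm_eq_of_mem_sphere, mul_one]

/-! ### Homotheties of `ℝ⁴` as diffeomorphisms -/

/-- The homothety `x ↦ c • x` (`c ≠ 0`) is a diffeomorphism of `ℝ⁴`. [folklore] -/
theorem exists_homothety {c : ℝ} (hc : c ≠ 0) :
    ∃ T : (EuclideanSpace ℝ (Fin 4)) ≃ₘ⟮𝓡 4, 𝓡 4⟯ (EuclideanSpace ℝ (Fin 4)), ∀ x, T x = c • x :=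
  ⟨{ toFun := fun x => c • x
     invFun := fun x => c⁻¹ • x
     left_inv := fun x => by simp [smul_smul, inv_mul_cancel₀ hc]
     right_inv := fun x => by simp [smul_smul, mul_inv_cancel₀ hc]
     contMDiff_toFun := (contDiff_const_smul c).contMDiff
     contMDiff_invFun := (contDiff_const_smul c⁻¹).contMDiff }, fun _ => rfl⟩

/-! ### The radial profile `g(x) = exp(radialStep ‖x‖ · (−log h(x̂)))` -/

/-- The radial profile is `C^∞` on all of `ℝ⁴`: it is constant `1` on the ball of radius `1/4`
and a composite of smooth maps off the origin. [folklore] -/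
theorem contDiff_profile (hh : ContMDiff (𝓡 3) 𝓘(ℝ, ℝ) ∞ h) (hpos : ∀ z, 0 < h z) :
    ContDiff ℝ ∞ (fun x : (EuclideanSpace ℝ (Fin 4)) =>
      Real.exp (radialStep ‖x‖ * -Real.log (h (radialProjection (sphereBasePoint 3) x)))) := by
  refine ContDiff.exp ?_
  refine contDiff_iff_contDiffAt.2 fun x => ?_
  by_cases hx : ‖x‖ < 1 / 4
  · refine (contDiffAt_const (c := (0 : ℝ))).congr_of_eventuallyEq ?_
    filter_upwards [Metric.isOpen_ball.mem_nhds (mem_ball_zero_iff.2 hx)] with y hy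
    rw [radialStep_of_le (mem_ball_zero_iff.1 hy).le, zero_mul]
  · have hx0 : x ≠ 0 := by
      rintro rfl
      exact hx (by rw [norm_zero]; norm_num)
    have h1 : ContDiffAt ℝ ∞ (fun y : (EuclideanSpace ℝ (Fin 4)) => radialStep ‖y‖) x :=
      contDiff_radialStep.contDiffAt.comp x (contDiffAt_norm ℝ hx0)
    have h2 : ContMDiffAt 𝓘(ℝ, (EuclideanSpace ℝ (Fin 4))) 𝓘(ℝ, ℝ) ∞
        (fun y : (EuclideanSpace ℝ (Fin 4)) => h (radialProjection (sphereBasePoint 3) y)) x :=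
      hh.contMDiffAt.comp x (contMDiffAt_radialProjection _ hx0)
    have h3 : ContDiffAt ℝ ∞
        (fun y : (EuclideanSpace ℝ (Fin 4)) => Real.log (h (radialProjection (sphereBasePoint 3)
            y))) x :=
      (contMDiffAt_iff_contDiffAt.1 h2).log (hpos _).ne'
    exact h1.mul h3.neg

/-- Off the origin and for `‖x‖ ≥ 1/2` the profile is `1 / h(x̂)`. [folklore] -/
theorem profile_eq_inv (hpos : ∀ z, 0 < h z) {x : (EuclideanSpace ℝ (Fin 4))} (hx : 1 / 2 ≤ ‖x‖) :
    Real.exp (radialStep ‖x‖ * -Real.log (h (radialProjection (sphereBasePoint 3) x))) =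
      (h (radialProjection (sphereBasePoint 3) x))⁻¹ := by
  rw [radialStep_of_ge hx, one_mul, Real.exp_neg, Real.exp_log (hpos _)]

/-- The profile is at most `1 / h(x̂)` when `h ≤ 1`. [folklore] -/
theorem profile_le_inv (hpos : ∀ z, 0 < h z) (hle : ∀ z, h z ≤ 1) (x : (EuclideanSpace ℝ (Fin 4))) :
    Real.exp (radialStep ‖x‖ * -Real.log (h (radialProjection (sphereBasePoint 3) x))) ≤
      (h (radialProjection (sphereBasePoint 3) x))⁻¹ := by
  have hc : 0 ≤ -Real.log (h (radialProjection (sphereBasePoint 3) x)) :=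
    neg_nonneg.2 (Real.log_nonpos (hpos _).le (hle _))
  calc Real.exp (radialStep ‖x‖ * -Real.log (h (radialProjection (sphereBasePoint 3) x)))
      ≤ Real.exp (-Real.log (h (radialProjection (sphereBasePoint 3) x))) :=
        Real.exp_le_exp.2 (mul_le_of_le_one_left hc (Real.smoothTransition.le_one _))
    _ = (h (radialProjection (sphereBasePoint 3) x))⁻¹ := by
        rw [Real.exp_neg, Real.exp_log (hpos _)]

/-- **The profile is radially non-decreasing** (`0 ≤ Dg_x(x)`) when `h ≤ 1`: along the ray
`t ↦ t • x` (`t > 0`) it is `exp(radialStep (t‖x‖) · c)` with `c = −log h(x̂) ≥ 0`, a monotone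
function of `t`, whose derivative at `t = 1` is `Dg_x(x)`. [folklore] -/
theorem profile_radial (hh : ContMDiff (𝓡 3) 𝓘(ℝ, ℝ) ∞ h) (hpos : ∀ z, 0 < h z)
    (hle : ∀ z, h z ≤ 1) (x : (EuclideanSpace ℝ (Fin 4))) :
    0 ≤ fderiv ℝ (fun x : (EuclideanSpace ℝ (Fin 4)) =>
      Real.exp (radialStep ‖x‖ * -Real.log (h (radialProjection (sphereBasePoint 3) x)))) x x := by
  by_cases hx : x = 0
  · rw [hx, map_zero]
  set g : (EuclideanSpace ℝ (Fin 4)) → ℝ := fun x =>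
    Real.exp (radialStep ‖x‖ * -Real.log (h (radialProjection (sphereBasePoint 3) x))) with hg
  set c : ℝ := -Real.log (h (radialProjection (sphereBasePoint 3) x)) with hc_def
  have hc : 0 ≤ c := neg_nonneg.2 (Real.log_nonpos (hpos _).le (hle _))
  have hd : DifferentiableAt ℝ g x :=
    (contDiff_profile h hh hpos).contDiffAt.differentiableAt (by simp)
  -- derivative along the ray at `t = 1`
  have hl : HasDerivAt (fun t : ℝ => t • x) x 1 := by
    simpa using (hasDerivAt_id (1 : ℝ)).smul_const x
  have hgx : HasFDerivAt g (fderiv ℝ g x) ((fun t : ℝ => t • x) 1) := by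
    simp only [one_smul]
    exact hd.hasFDerivAt
  have h1 : HasDerivAt (fun t : ℝ => g (t • x)) (fderiv ℝ g x x) 1 := by
    have h1' := hgx.comp_hasDerivAt (1 : ℝ) hl
    exact h1'
  -- the globally monotone model of the ray function
  set γ : ℝ → ℝ := fun t => Real.exp (radialStep (t * ‖x‖) * c) with hγ
  have hmono : Monotone γ := by
    intro s t hst
    refine Real.exp_le_exp.2 (mul_le_mul_of_nonneg_right ?_ hc)
    exact Real.smoothTransition.monotone
      (by nlinarith [mul_le_mul_of_nonneg_right hst (norm_nonneg x)])
  have heq : γ =ᶠ[𝓝 1] fun t => g (t • x) := by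
    filter_upwards [Ioi_mem_nhds one_pos] with t ht
    simp only [hγ, hg, hc_def]
    rw [norm_smul, Real.norm_eq_abs, abs_of_pos ht, radialProjection_smul_of_pos ht hx]
  have h3 : HasDerivAt γ (fderiv ℝ g x x) 1 := h1.congr_of_eventuallyEq heq
  exact h3.nonneg_of_monotone hmono

/-! ### The core statement, for `h ≤ 1` -/

/-- **Core of Z3b** under the normalisation `h ≤ 1`. [cite: Geiges2008, proof of Prop. 4.11.2] -/
theorem core
    (hZ3a : ∀ g : (EuclideanSpace ℝ (Fin 4)) → ℝ, ContDiff ℝ ∞ g → (∀ x, 0 < g x) → (∀ x :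
        (EuclideanSpace ℝ (Fin 4)), 0 ≤ fderiv ℝ g x x) →
      ∃ D : (EuclideanSpace ℝ (Fin 4)) ≃ₘ⟮𝓡 4, 𝓡 4⟯ (EuclideanSpace ℝ (Fin 4)), ∀ x, D x = g x • x)
    (hh : ContMDiff (𝓡 3) 𝓘(ℝ, ℝ) ∞ h) (hpos : ∀ z, 0 < h z) (hle : ∀ z, h z ≤ 1)
    {C : (EuclideanSpace ℝ (Fin 4)) → (EuclideanSpace ℝ (Fin 4))}
    (hC : ∀ y : (EuclideanSpace ℝ (Fin 4)), C y = (‖y‖ * h (radialProjection (sphereBasePoint 3)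
        y)) •
      ((ψ (radialProjection (sphereBasePoint 3) y) : (Metric.sphere (0 : EuclideanSpace ℝ (Fin 4))
          1)) : (EuclideanSpace ℝ (Fin 4))))
    (Φ : (EuclideanSpace ℝ (Fin 4)) ≃ₘ⟮𝓡 4, 𝓡 4⟯ (EuclideanSpace ℝ (Fin 4))) {K' : Set
        (EuclideanSpace ℝ (Fin 4))} (hK' : IsCompact K')
    (hΦ : ∀ x, x ∉ K' → Φ x = C x) :
    ExtendsOverBall 3 ψ := by
  -- Step 1: `K' ⊆ B(0, ρ₀)`
  obtain ⟨ρ₀, hρ₀, hK'sub⟩ := hK'.isBounded.subset_ball_lt 0 0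
  -- Step 2: conical rescaling `Φl = λ⁻¹ Φ(λ ·)`, `λ = 4 ρ₀`, equal to `C` off `B̄(0, 1/4)`
  set lam : ℝ := 4 * ρ₀ with hlam
  have hlam_pos : 0 < lam := by positivity
  obtain ⟨T₁, hT₁⟩ := exists_homothety hlam_pos.ne'
  obtain ⟨T₂, hT₂⟩ := exists_homothety (inv_ne_zero hlam_pos.ne')
  set Φl : (EuclideanSpace ℝ (Fin 4)) ≃ₘ⟮𝓡 4, 𝓡 4⟯ (EuclideanSpace ℝ (Fin 4)) := T₁.trans (Φ.trans
      T₂) with hΦl_def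
  have hΦl : ∀ x : (EuclideanSpace ℝ (Fin 4)), 1 / 4 < ‖x‖ → Φl x = C x := by
    intro x hx
    have hxK : lam • x ∉ K' := by
      intro hmem
      have hlt := hK'sub hmem
      rw [mem_ball_zero_iff, norm_smul, Real.norm_eq_abs, abs_of_pos hlam_pos, hlam] at hlt
      nlinarith
    show T₂ (Φ (T₁ x)) = C x
    rw [hT₁, hΦ _ hxK, hT₂, cone_smul_eq ψ h hC hlam_pos, smul_smul, inv_mul_cancel₀ hlam_pos.ne',
      one_smul]
  -- Step 3: the radial straightening `D x = g x • x`
  set g : (EuclideanSpace ℝ (Fin 4)) → ℝ := fun x =>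
    Real.exp (radialStep ‖x‖ * -Real.log (h (radialProjection (sphereBasePoint 3) x))) with hg
  have hgpos : ∀ x, 0 < g x := fun x => Real.exp_pos _
  obtain ⟨D, hD⟩ := hZ3a g (contDiff_profile h hh hpos) hgpos (profile_radial h hh hpos hle)
  -- Step 4: `D '' 𝔻 = S` and `Φl '' S = 𝔻`
  set S : Set (EuclideanSpace ℝ (Fin 4)) := {x | ‖x‖ * h (radialProjection (sphereBasePoint 3) x) ≤
      1} with hS
  have hDS : D '' closedBall (0 : (EuclideanSpace ℝ (Fin 4))) 1 = S := by
    apply Subset.antisymm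
    · rintro _ ⟨x, hx, rfl⟩
      rw [mem_closedBall_zero_iff] at hx
      show ‖D x‖ * h (radialProjection (sphereBasePoint 3) (D x)) ≤ 1
      rw [hD]
      by_cases hx0 : x = 0
      · subst hx0
        rw [smul_zero, norm_zero, zero_mul]
        exact zero_le_one
      rw [norm_smul, Real.norm_eq_abs, abs_of_pos (hgpos x), radialProjection_smul_of_pos (hgpos x)
          hx0]
      have hhx := hpos (radialProjection (sphereBasePoint 3) x)
      calc g x * ‖x‖ * h (radialProjection (sphereBasePoint 3) x)
          ≤ (h (radialProjection (sphereBasePoint 3) x))⁻¹ * ‖x‖ *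
              h (radialProjection (sphereBasePoint 3) x) := by
            gcongr
            exact profile_le_inv h hpos hle x
        _ = ‖x‖ := by field_simp
        _ ≤ 1 := hx
    · intro y hy
      obtain ⟨x, rfl⟩ := D.toEquiv.surjective y
      rw [Diffeomorph.coe_toEquiv] at hy ⊢
      refine ⟨x, ?_, rfl⟩
      rw [mem_closedBall_zero_iff]
      by_contra hgt
      rw [not_le] at hgt
      have hx0 : x ≠ 0 := by
        rintro rfl
        rw [norm_zero] at hgt
        exact absurd hgt (by norm_num)
      have hyS : ‖D x‖ * h (radialProjection (sphereBasePoint 3) (D x)) ≤ 1 := hy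
      rw [hD, norm_smul, Real.norm_eq_abs, abs_of_pos (hgpos x),
        radialProjection_smul_of_pos (hgpos x) hx0,
        show g x = (h (radialProjection (sphereBasePoint 3) x))⁻¹ from
          profile_eq_inv h hpos (by linarith)] at hyS
      have hhx := hpos (radialProjection (sphereBasePoint 3) x)
      have : (h (radialProjection (sphereBasePoint 3) x))⁻¹ * ‖x‖ *
          h (radialProjection (sphereBasePoint 3) x) = ‖x‖ := by field_simp
      rw [this] at hyS
      linarith
  have hbij : Bijective Φl := by
    rw [← Diffeomorph.coe_toEquiv]; exact Φl.toEquiv.bijective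
  have hcompl : Φl '' Sᶜ = (closedBall (0 : (EuclideanSpace ℝ (Fin 4))) 1)ᶜ := by
    apply Subset.antisymm
    · rintro _ ⟨x, hx, rfl⟩
      rw [mem_compl_iff, hS, mem_setOf_eq, not_le] at hx
      have hx1 : 1 < ‖x‖ :=
        lt_of_lt_of_le hx (mul_le_of_le_one_right (norm_nonneg _) (hle _))
      rw [hΦl x (by linarith), mem_compl_iff, mem_closedBall_zero_iff, not_le,
        norm_cone_eq ψ h hC hpos]
      exact hx
    · intro y hy
      rw [mem_compl_iff, mem_closedBall_zero_iff, not_le] at hy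
      set z : (Metric.sphere (0 : EuclideanSpace ℝ (Fin 4)) 1) := ψ.symm (radialProjection
          (sphereBasePoint 3) y) with hz
      have ht : 0 < ‖y‖ / h z := div_pos (by linarith) (hpos z)
      set x : (EuclideanSpace ℝ (Fin 4)) := (‖y‖ / h z) • (z : (EuclideanSpace ℝ (Fin 4))) with hx
      have hxnorm : ‖x‖ = ‖y‖ / h z := by
        rw [hx, norm_smul, Real.norm_eq_abs, abs_of_pos ht, norm_eq_of_mem_sphere, mul_one]
      have hyle : ‖y‖ ≤ ‖y‖ / h z := by
        rw [le_div_iff₀ (hpos z)]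
        exact mul_le_of_le_one_right (norm_nonneg _) (hle z)
      have hx1 : 1 < ‖x‖ := by rw [hxnorm]; exact lt_of_lt_of_le hy hyle
      have hCx : C x = y := by
        rw [hx, cone_smul_coe ψ h hC ht z, div_mul_cancel₀ _ (hpos z).ne', hz,
          Diffeomorph.apply_symm_apply, norm_smul_coe_radialProjection]
      refine ⟨x, ?_, ?_⟩
      · rw [mem_compl_iff, hS, mem_setOf_eq, not_le, hx, radialProjection_smul _ ht z, ← hx, hxnorm,
          div_mul_cancel₀ _ (hpos z).ne']
        exact hy
      · rw [hΦl x (by linarith), hCx]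
  have hΦlS : Φl '' S = closedBall (0 : (EuclideanSpace ℝ (Fin 4))) 1 := by
    have key := Set.image_compl_eq (f := Φl) (s := S) hbij
    rw [hcompl] at key
    exact (compl_injective key).symm
  -- Step 5: `G = Φl ∘ D` preserves the closed ball both ways
  set G : (EuclideanSpace ℝ (Fin 4)) ≃ₘ⟮𝓡 4, 𝓡 4⟯ (EuclideanSpace ℝ (Fin 4)) := D.trans Φl with hG
  have hGball : G '' closedBall (0 : (EuclideanSpace ℝ (Fin 4))) 1 = closedBall (0 :
      (EuclideanSpace ℝ (Fin 4))) 1 := by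
    rw [hG, Diffeomorph.coe_trans, image_comp, hDS, hΦlS]
  have hmaps : MapsTo G (closedBall (0 : (EuclideanSpace ℝ (Fin 4))) 1) (closedBall (0 :
      (EuclideanSpace ℝ (Fin 4))) 1) := by
    intro x hx
    rw [← hGball]
    exact mem_image_of_mem G hx
  have hmaps' : MapsTo G.symm (closedBall (0 : (EuclideanSpace ℝ (Fin 4))) 1) (closedBall (0 :
      (EuclideanSpace ℝ (Fin 4))) 1) := by
    intro y hy
    rw [← hGball] at hy
    obtain ⟨x, hx, rfl⟩ := hy
    rw [Diffeomorph.symm_apply_apply]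
    exact hx
  -- Step 6: boundary values `G z = ψ z`
  have hbdry : ∀ z : (Metric.sphere (0 : EuclideanSpace ℝ (Fin 4)) 1), G (z : (EuclideanSpace ℝ
      (Fin 4))) = ((ψ z : (Metric.sphere (0 : EuclideanSpace ℝ (Fin 4)) 1)) : (EuclideanSpace ℝ
          (Fin 4))) := by
    intro z
    have hz1 : ‖(z : (EuclideanSpace ℝ (Fin 4)))‖ = 1 := norm_eq_of_mem_sphere z
    have hgz : g z = (h z)⁻¹ := by
      simp only [hg]
      rw [hz1, radialStep_one, one_mul, radialProjection_coe_sphere, Real.exp_neg,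
        Real.exp_log (hpos z)]
    have hDz : D z = (h z)⁻¹ • (z : (EuclideanSpace ℝ (Fin 4))) := by rw [hD, hgz]
    have hnormDz : 1 / 4 < ‖D (z : (EuclideanSpace ℝ (Fin 4)))‖ := by
      rw [hDz, norm_smul, Real.norm_eq_abs, abs_of_pos (inv_pos.2 (hpos z)), hz1, mul_one]
      have : 1 ≤ (h z)⁻¹ := (one_le_inv₀ (hpos z)).2 (hle z)
      linarith
    show Φl (D z) = _
    rw [hΦl _ hnormDz, hDz, cone_smul_coe ψ h hC (inv_pos.2 (hpos z)) z,
      inv_mul_cancel₀ (hpos z).ne', one_smul]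
  refine ⟨Diffeomorph.closedBallRestrict G hmaps hmaps', fun z => Subtype.ext ?_⟩
  rw [Diffeomorph.coe_closedBallRestrict]
  exact hbdry z

end ConeGermExtendsOverBall

/-- **Stub Z3b — a diffeomorphism of `ℝ⁴` with a conical germ at infinity restricts, after conical
rescaling and radial straightening, to an extension of `ψ` over the closed 4-ball**, given the
radial-diffeomorphism lemma Z3a as first hypothesis.  Data: `h > 0` smooth on `S³`,
`ψ ∈ Diff S³`, `C(y) = ‖y‖ h(ŷ) ψ(ŷ)`, `Φ ∈ Diff ℝ⁴` with `Φ = C` off a compact `K'`.  Proof: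
normalise `max h ≤ 1` by a homothety, then `ConeGermExtendsOverBall.core` (conical rescaling,
radial straightening `x ↦ exp(radialStep ‖x‖ · log(1/h x̂)) • x`, set bookkeeping
`D(𝔻⁴) = {‖x‖ h(x̂) ≤ 1}`, `Φ_λ({‖x‖ h(x̂) ≤ 1}) = 𝔻⁴`, boundary identity `C(z / h z) = ψ z`,
`Diffeomorph.closedBallRestrict`).
[cite: Geiges2008, proof of Prop. 4.11.2 (last paragraph: rescaling the filling to the unit ball)]
    -/
theorem stub_coneGerm_extendsOverBall :
    (∀ g : E4 → ℝ, ContDiff ℝ ∞ g → (∀ x, 0 < g x) → (∀ x : E4, 0 ≤ fderiv ℝ g x x) →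
      ∃ D : E4 ≃ₘ⟮𝓡 4, 𝓡 4⟯ E4, ∀ x, D x = g x • x) →
    ∀ (ψ : 𝕊³ ≃ₘ⟮𝓡 3, 𝓡 3⟯ 𝕊³) (h : 𝕊³ → ℝ) (C : E4 → E4),
      ContMDiff (𝓡 3) 𝓘(ℝ, ℝ) ∞ h → (∀ z, 0 < h z) →
      (∀ y : E4, C y =
        (‖y‖ * h (radialProjection (sphereBasePoint 3) y)) •
          ((ψ (radialProjection (sphereBasePoint 3) y) : 𝕊³) : E4)) →
      ∀ Φ : E4 ≃ₘ⟮𝓡 4, 𝓡 4⟯ E4,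
        (∃ K' : Set E4, IsCompact K' ∧ ∀ x, x ∉ K' → Φ x = C x) →
        ExtendsOverBall 3 ψ := by
  intro hZ3a ψ h C hh hpos hC Φ hΦK
  obtain ⟨K', hK', hΦ⟩ := hΦK
  -- the maximum `M` of `h` on the compact sphere
  haveI : Nonempty (Metric.sphere (0 : EuclideanSpace ℝ (Fin 4)) 1) := ⟨sphereBasePoint 3⟩
  obtain ⟨z₀, -, hz₀⟩ :=
    isCompact_univ.exists_isMaxOn univ_nonempty hh.continuous.continuousOn
  set M : ℝ := h z₀ with hM_def
  have hM : 0 < M := hpos z₀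
  have hleM : ∀ z, h z ≤ M := fun z => isMaxOn_iff.1 hz₀ z (mem_univ z)
  obtain ⟨T, hT⟩ := ConeGermExtendsOverBall.exists_homothety (inv_ne_zero hM.ne')
  refine ConeGermExtendsOverBall.core ψ (fun z => h z * M⁻¹) hZ3a (hh.mul contMDiff_const)
    (fun z => mul_pos (hpos z) (inv_pos.2 hM)) (fun z => ?_) (C := fun y => M⁻¹ • C y) ?_
    (Φ.trans T) hK' ?_
  · rw [mul_inv_le_iff₀ hM, one_mul]
    exact hleM z
  · intro y
    rw [hC, smul_smul]
    congr 1
    ring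
  · intro x hx
    show T (Φ x) = M⁻¹ • C x
    rw [hT, hΦ x hx]

end Summit.SmoothPoincare4.SmoothPoincare4.Theorems.SchsplitCerf.ContactIsotopyGromovCone

end
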